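import Literature.Computability.AlgebraicComplexity.CwLaserBlocks

/-!
# Laser blocks for the permutation-twisted Coppersmith–Winograd tensors `T_cw,q^τ`

Solo deliverable (informed mode).  Support rank depends on the basis, so the s-rank door
(`SoloInformedSupportDoor`) is one door per basis in which `T_cw,q` keeps its laser structure.  Up
to relabelling the three bases separately, the tensors on `(K^{q+1})^{⊗3}` with the COARSE
support of `T_cw,q` (a non-zero entry has exactly one zero coordinate) and PERMUTATION fine
blocks are the twisted tensors
`T_cw,q^τ = ∑_{j=1}^q e₀⊗e_j⊗e_j + e_j⊗e₀⊗e_j + e_{τ j}⊗e_j⊗e₀`, `τ ∈ S_q`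
(conjugate `τ` give relabelled tensors; `τ = 1` is `T_cw,q`; for `q = 2`, `τ = (1 2)` is, after
relabelling two of the three bases, the Levi-Civita-pattern tensor `P(i,j,k) = [i,j,k distinct]`,
which is isomorphic to `T_cw,2` but has a different support).  This file ports the tree's
combinatorial laser restriction `cw_kroneckerPow_blocks` (BCS Thm. 15.41, proof) to every
`T_cw,q^τ`:
the Kronecker power `(T_cw,q^τ)^{⊗N}` contains, along index maps, the block sum
`⟨|Δ|⟩ ⊗ ⟨q^m,q^m,q^m⟩` for every free diagonal `Δ` of balanced ordered partitions — the twist is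
absorbed into the index map of the first factor.  The s-rank doors for all `T_cw,q^τ` follow in
`SoloInformedTwistedDoor`.

## References
* P. Bürgisser, M. Clausen, M. A. Shokrollahi, *Algebraic Complexity Theory* (1997), Thm. 15.41
  and its proof, pp. 381–383. [BurgisserClausenShokrollahi1997]
* H. Cohn, C. Umans, *Fast matrix multiplication using coherent configurations*, SODA 2013,
  arXiv:1207.6528, §3. [CohnUmans2013]
-/

noncomputable section

open scoped BigOperators
open Finset

namespace Summit.MatrixMultiplication.MatrixMultiplication.Theorems.SupportRankDoor

open Literature.Computability.AlgebraicComplexity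

universe u

variable (K : Type u) [CommSemiring K]

/-- The twist on indices: `0 ↦ 0`, `x+1 ↦ τ(x)+1`. [cite: CohnUmans2013, §3] -/
def twistSucc {q : ℕ} (τ : Equiv.Perm (Fin q)) (j : Fin (q + 1)) : Fin (q + 1) :=
  Fin.cases 0 (fun x => (τ x).succ) j

omit K in
/-- `twistSucc τ 0 = 0`. [cite: CohnUmans2013, §3] -/
@[simp] theorem twistSucc_zero {q : ℕ} (τ : Equiv.Perm (Fin q)) : twistSucc τ 0 = 0 := by
  simp [twistSucc]

omit K in
/-- `twistSucc τ (x+1) = τ(x)+1`. [cite: CohnUmans2013, §3] -/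
@[simp] theorem twistSucc_succ {q : ℕ} (τ : Equiv.Perm (Fin q)) (x : Fin q) :
    twistSucc τ x.succ = (τ x).succ := by
  simp [twistSucc]

/-- **The twisted Coppersmith–Winograd tensor** `T_cw,q^τ`: entry `1` at `(0,j,j)`, `(j,0,j)` and
`(τ j, j, 0)` for `1 ≤ j ≤ q` (with `τ` transported to `{1,…,q}`), `0` elsewhere.
[cite: BurgisserClausenShokrollahi1997, §15.8 (p. 383)] -/
def twistedCwTensor (q : ℕ) (τ : Equiv.Perm (Fin q)) :
    Fin (q + 1) → Fin (q + 1) → Fin (q + 1) → K :=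
  fun i j k =>
    if (i = 0 ∧ j = k ∧ j ≠ 0) ∨ (j = 0 ∧ i = k ∧ i ≠ 0) ∨ (k = 0 ∧ j ≠ 0 ∧ i = twistSucc τ j)
    then 1 else 0

/-- Entries of `T_cw,q^τ`. [cite: BurgisserClausenShokrollahi1997, §15.8 (p. 383)] -/
theorem twistedCwTensor_apply (q : ℕ) (τ : Equiv.Perm (Fin q)) (i j k : Fin (q + 1)) :
    twistedCwTensor K q τ i j k =
      if (i = 0 ∧ j = k ∧ j ≠ 0) ∨ (j = 0 ∧ i = k ∧ i ≠ 0) ∨ (k = 0 ∧ j ≠ 0 ∧ i = twistSucc τ j)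
      then 1 else 0 :=
  rfl

/-- `τ = 1` gives back `T_cw,q`. [cite: BurgisserClausenShokrollahi1997, §15.8 (p. 383)] -/
theorem twistedCwTensor_one (q : ℕ) : twistedCwTensor K q 1 = cwTensor K q := by
  funext i j k
  rw [twistedCwTensor_apply, cwTensor_apply]
  have h3 : (k = 0 ∧ j ≠ 0 ∧ i = twistSucc (1 : Equiv.Perm (Fin q)) j) ↔
      (k = 0 ∧ i = j ∧ i ≠ 0) := by
    induction j using Fin.cases with
    | zero => simp
    | succ x =>
      simp only [twistSucc_succ, Equiv.Perm.coe_one, id_eq, ne_eq, Fin.succ_ne_zero,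
        not_false_eq_true, true_and]
      constructor
      · rintro ⟨hk, rfl⟩; exact ⟨hk, rfl, Fin.succ_ne_zero _⟩
      · rintro ⟨hk, h, -⟩; exact ⟨hk, h⟩
  simp only [h3]

/-! ## Entries on the blocks -/

/-- Block `(0,1,1)`: `T^τ(0, x+1, y+1) = [x = y]`.
[cite: BurgisserClausenShokrollahi1997, §15.8 (p. 383)] -/
theorem twistedCwTensor_zero_succ_succ (q : ℕ) (τ : Equiv.Perm (Fin q)) (x y : Fin q) :
    twistedCwTensor K q τ 0 x.succ y.succ = if x = y then 1 else 0 := by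
  simp only [twistedCwTensor_apply, Fin.succ_inj, Fin.succ_ne_zero, ne_eq, not_false_eq_true,
    and_true, true_and, false_and, or_false]

/-- Block `(1,0,1)`: `T^τ(x+1, 0, y+1) = [x = y]`.
[cite: BurgisserClausenShokrollahi1997, §15.8 (p. 383)] -/
theorem twistedCwTensor_succ_zero_succ (q : ℕ) (τ : Equiv.Perm (Fin q)) (x y : Fin q) :
    twistedCwTensor K q τ x.succ 0 y.succ = if x = y then 1 else 0 := by
  simp only [twistedCwTensor_apply, Fin.succ_inj, Fin.succ_ne_zero, ne_eq, not_false_eq_true,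
    and_true, true_and, false_and, or_false, false_or, (Fin.succ_ne_zero y).symm, and_false,
    not_true_eq_false]

/-- Block `(1,1,0)`, twisted: `T^τ((τ x)+1, y+1, 0) = [x = y]`.
[cite: BurgisserClausenShokrollahi1997, §15.8 (p. 383)] -/
theorem twistedCwTensor_twist_succ_zero (q : ℕ) (τ : Equiv.Perm (Fin q)) (x y : Fin q) :
    twistedCwTensor K q τ (τ x).succ y.succ 0 = if x = y then 1 else 0 := by
  simp only [twistedCwTensor_apply, twistSucc_succ, Fin.succ_inj, Fin.succ_ne_zero, ne_eq,
    not_false_eq_true, true_and, false_and, false_or, EmbeddingLike.apply_eq_iff_eq, and_false]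

/-- Coarse support: a non-zero entry of `T_cw,q^τ` has exactly one zero coordinate.
[cite: BurgisserClausenShokrollahi1997, §15.8 (p. 383)] -/
theorem twistedCwTensor_ne_zero_pattern (q : ℕ) (τ : Equiv.Perm (Fin q)) {i j k : Fin (q + 1)}
    (h : twistedCwTensor K q τ i j k ≠ 0) :
    (i = 0 ∧ j ≠ 0 ∧ k ≠ 0) ∨ (j = 0 ∧ i ≠ 0 ∧ k ≠ 0) ∨ (k = 0 ∧ i ≠ 0 ∧ j ≠ 0) := by
  rw [twistedCwTensor_apply] at h
  split_ifs at h with hc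
  · rcases hc with ⟨h1, h2, h3⟩ | ⟨h1, h2, h3⟩ | ⟨h1, h2, h3⟩
    · exact Or.inl ⟨h1, h3, h2 ▸ h3⟩
    · exact Or.inr (Or.inl ⟨h1, h3, h2 ▸ h3⟩)
    · refine Or.inr (Or.inr ⟨h1, ?_, h2⟩)
      obtain ⟨x, rfl⟩ := Fin.exists_succ_eq.2 h2
      rw [h3, twistSucc_succ]
      exact Fin.succ_ne_zero _
  · exact absurd rfl h

/-! ## One block of `(T^τ)^{⊗N}` -/

/-- The diagonal blocks of `(T_cw,q^τ)^{⊗N}` are matrix multiplication tensors: as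
`cw_block_diag`, with the first index twisted by `τ` on the positions of `C`.
[cite: BurgisserClausenShokrollahi1997, Thm. 15.41 (proof, p. 381)] -/
theorem twisted_block_diag {N q m : ℕ} (τ : Equiv.Perm (Fin q)) {A B C : Finset (Fin N)}
    (hAB : Disjoint A B) (hAC : Disjoint A C) (hBC : Disjoint B C) (hcov : A ∪ B ∪ C = Finset.univ)
    (eA : ↥A ≃ Fin m) (eB : ↥B ≃ Fin m) (eC : ↥C ≃ Fin m) (κ ν κ' μ μ' ν' : Fin m → Fin q)
    (a b c : Fin N → Fin (q + 1))
    (ha0 : ∀ ρ ∈ A, a ρ = 0) (haC : ∀ ρ (h : ρ ∈ C), a ρ = (τ (κ (eC ⟨ρ, h⟩))).succ)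
    (haB : ∀ ρ (h : ρ ∈ B), a ρ = (ν (eB ⟨ρ, h⟩)).succ)
    (hb0 : ∀ ρ ∈ B, b ρ = 0) (hbC : ∀ ρ (h : ρ ∈ C), b ρ = (κ' (eC ⟨ρ, h⟩)).succ)
    (hbA : ∀ ρ (h : ρ ∈ A), b ρ = (μ (eA ⟨ρ, h⟩)).succ)
    (hc0 : ∀ ρ ∈ C, c ρ = 0) (hcA : ∀ ρ (h : ρ ∈ A), c ρ = (μ' (eA ⟨ρ, h⟩)).succ)
    (hcB : ∀ ρ (h : ρ ∈ B), c ρ = (ν' (eB ⟨ρ, h⟩)).succ) :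
    ∏ ρ, twistedCwTensor K q τ (a ρ) (b ρ) (c ρ) =
      if κ = κ' ∧ μ = μ' ∧ ν = ν' then 1 else 0 := by
  classical
  have hAuBC : Disjoint (A ∪ B) C := Finset.disjoint_union_left.2 ⟨hAC, hBC⟩
  rw [← hcov, Finset.prod_union hAuBC, Finset.prod_union hAB]
  have hA : ∏ ρ ∈ A, twistedCwTensor K q τ (a ρ) (b ρ) (c ρ) =
      ∏ r, if μ r = μ' r then (1 : K) else 0 := by
    rw [← Finset.prod_coe_sort A]
    refine Fintype.prod_equiv eA _ _ fun i => ?_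
    rw [ha0 _ i.2, hbA _ i.2, hcA _ i.2, twistedCwTensor_zero_succ_succ]
  have hB : ∏ ρ ∈ B, twistedCwTensor K q τ (a ρ) (b ρ) (c ρ) =
      ∏ r, if ν r = ν' r then (1 : K) else 0 := by
    rw [← Finset.prod_coe_sort B]
    refine Fintype.prod_equiv eB _ _ fun i => ?_
    rw [hb0 _ i.2, haB _ i.2, hcB _ i.2, twistedCwTensor_succ_zero_succ]
  have hC : ∏ ρ ∈ C, twistedCwTensor K q τ (a ρ) (b ρ) (c ρ) =
      ∏ r, if κ r = κ' r then (1 : K) else 0 := by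
    rw [← Finset.prod_coe_sort C]
    refine Fintype.prod_equiv eC _ _ fun i => ?_
    rw [hc0 _ i.2, haC _ i.2, hbC _ i.2, twistedCwTensor_twist_succ_zero]
  rw [hA, hB, hC]
  have hone : ∀ u : Fin m → Fin q, ∏ r, (if u r = u r then (1 : K) else 0) = 1 := fun u => by simp
  have hzero : ∀ u v : Fin m → Fin q, u ≠ v → ∏ r, (if u r = v r then (1 : K) else 0) = 0 := by
    intro u v h
    obtain ⟨r, hr⟩ := Function.ne_iff.1 h
    exact Finset.prod_eq_zero (Finset.mem_univ r) (if_neg hr)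
  by_cases h : κ = κ' ∧ μ = μ' ∧ ν = ν'
  · obtain ⟨rfl, rfl, rfl⟩ := h
    rw [if_pos ⟨rfl, rfl, rfl⟩, hone, hone, hone, one_mul, one_mul]
  · rw [if_neg h]
    by_cases hκ : κ = κ'
    · by_cases hμ : μ = μ'
      · have hν : ν ≠ ν' := fun hν => h ⟨hκ, hμ, hν⟩
        rw [hzero _ _ hν, mul_zero, zero_mul]
      · rw [hzero _ _ hμ, zero_mul, zero_mul]
    · rw [hzero _ _ hκ, mul_zero]

/-- Off-diagonal blocks vanish unless the zero sets form a partition (coarse support only).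
[cite: BurgisserClausenShokrollahi1997, Thm. 15.41 (proof, p. 381)] -/
theorem twisted_block_support {N q : ℕ} (τ : Equiv.Perm (Fin q)) {A B C : Finset (Fin N)}
    (a b c : Fin N → Fin (q + 1))
    (ha : ∀ ρ, a ρ = 0 ↔ ρ ∈ A) (hb : ∀ ρ, b ρ = 0 ↔ ρ ∈ B) (hc : ∀ ρ, c ρ = 0 ↔ ρ ∈ C)
    (hne : ∏ ρ, twistedCwTensor K q τ (a ρ) (b ρ) (c ρ) ≠ 0) :
    Disjoint A B ∧ Disjoint A C ∧ Disjoint B C ∧ A ∪ B ∪ C = Finset.univ := by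
  classical
  have hρ : ∀ ρ, twistedCwTensor K q τ (a ρ) (b ρ) (c ρ) ≠ 0 := fun ρ h =>
    hne (Finset.prod_eq_zero (Finset.mem_univ ρ) h)
  have hpat := fun ρ => twistedCwTensor_ne_zero_pattern K q τ (hρ ρ)
  refine ⟨?_, ?_, ?_, ?_⟩
  · rw [Finset.disjoint_left]
    intro ρ hA hB
    rcases hpat ρ with ⟨-, h2, -⟩ | ⟨-, h1, -⟩ | ⟨-, h1, -⟩
    · exact h2 ((hb ρ).2 hB)
    · exact h1 ((ha ρ).2 hA)
    · exact h1 ((ha ρ).2 hA)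
  · rw [Finset.disjoint_left]
    intro ρ hA hC
    rcases hpat ρ with ⟨-, -, h3⟩ | ⟨-, h1, -⟩ | ⟨-, h1, -⟩
    · exact h3 ((hc ρ).2 hC)
    · exact h1 ((ha ρ).2 hA)
    · exact h1 ((ha ρ).2 hA)
  · rw [Finset.disjoint_left]
    intro ρ hB hC
    rcases hpat ρ with ⟨-, h2, -⟩ | ⟨-, -, h3⟩ | ⟨-, -, h2⟩
    · exact h2 ((hb ρ).2 hB)
    · exact h3 ((hc ρ).2 hC)
    · exact h2 ((hb ρ).2 hB)
  · refine Finset.eq_univ_of_forall fun ρ => ?_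
    simp only [Finset.mem_union]
    rcases hpat ρ with ⟨h1, -, -⟩ | ⟨h2, -, -⟩ | ⟨h3, -, -⟩
    · exact Or.inl (Or.inl ((ha ρ).1 h1))
    · exact Or.inl (Or.inr ((hb ρ).1 h2))
    · exact Or.inr ((hc ρ).1 h3)

/-! ## The Kronecker power contains `⟨|Δ|⟩ ⊗ ⟨q^m,q^m,q^m⟩` along a free diagonal -/

/-- **Laser blocks for `T_cw,q^τ`**: for a free diagonal `Δ` of ordered partitions of the `N`
positions into blocks of size `m`, there are index maps `F, G, H` with
`⟨|Δ|⟩ ⊗ ⟨q^m,q^m,q^m⟩ = (T_cw,q^τ)^{⊗N} ∘ (F × G × H)`; the twist `τ` sits in `F` on the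
`C`-blocks.
[cite: BurgisserClausenShokrollahi1997, Thm. 15.41 (proof, p. 381)] -/
theorem twisted_kroneckerPow_blocks (q m N : ℕ) (τ : Equiv.Perm (Fin q))
    (Δ : Finset (Finset (Fin N) × Finset (Fin N) × Finset (Fin N)))
    (hcard : ∀ δ ∈ Δ, δ.1.card = m ∧ δ.2.1.card = m ∧ δ.2.2.card = m)
    (hpart : ∀ δ ∈ Δ, Disjoint δ.1 δ.2.1 ∧ Disjoint δ.1 δ.2.2 ∧ Disjoint δ.2.1 δ.2.2 ∧
      δ.1 ∪ δ.2.1 ∪ δ.2.2 = Finset.univ)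
    (hfree : ∀ δ ∈ Δ, ∀ δ' ∈ Δ, ∀ δ'' ∈ Δ, Disjoint δ.1 δ'.2.1 → Disjoint δ.1 δ''.2.2 →
      Disjoint δ'.2.1 δ''.2.2 → δ.1 ∪ δ'.2.1 ∪ δ''.2.2 = Finset.univ → δ = δ' ∧ δ' = δ'') :
    ∃ (F G H : Fin Δ.card × (Fin (q ^ m) × Fin (q ^ m)) → (Fin N → Fin (q + 1))),
      kroneckerTensor (unitTensor K Δ.card) (matMulTensor K (q ^ m) (q ^ m) (q ^ m)) =
        fun x y z => kroneckerPow (twistedCwTensor K q τ) N (F x) (G y) (H z) := by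
  classical
  let δ : Fin Δ.card → Finset (Fin N) × Finset (Fin N) × Finset (Fin N) :=
    fun s => (Δ.equivFin.symm s).1
  have hδmem : ∀ s, δ s ∈ Δ := fun s => (Δ.equivFin.symm s).2
  have hδinj : Function.Injective δ :=
    Subtype.val_injective.comp Δ.equivFin.symm.injective
  let eA : ∀ s, ↥(δ s).1 ≃ Fin m := fun s => Finset.equivFinOfCardEq (hcard _ (hδmem s)).1
  let eB : ∀ s, ↥(δ s).2.1 ≃ Fin m := fun s => Finset.equivFinOfCardEq (hcard _ (hδmem s)).2.1
  let eC : ∀ s, ↥(δ s).2.2 ≃ Fin m := fun s => Finset.equivFinOfCardEq (hcard _ (hδmem s)).2.2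
  let f : Fin (q ^ m) → Fin m → Fin q := fun κ => finFunctionFinEquiv.symm κ
  have hf : ∀ κ κ' : Fin (q ^ m), f κ = f κ' ↔ κ = κ' := fun κ κ' =>
    finFunctionFinEquiv.symm.injective.eq_iff
  let F : Fin Δ.card × (Fin (q ^ m) × Fin (q ^ m)) → Fin N → Fin (q + 1) := fun x ρ =>
    if h : ρ ∈ (δ x.1).2.2 then (τ (f x.2.1 (eC x.1 ⟨ρ, h⟩))).succ
    else if h' : ρ ∈ (δ x.1).2.1 then (f x.2.2 (eB x.1 ⟨ρ, h'⟩)).succ else 0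
  let G : Fin Δ.card × (Fin (q ^ m) × Fin (q ^ m)) → Fin N → Fin (q + 1) := fun y ρ =>
    if h : ρ ∈ (δ y.1).2.2 then (f y.2.1 (eC y.1 ⟨ρ, h⟩)).succ
    else if h' : ρ ∈ (δ y.1).1 then (f y.2.2 (eA y.1 ⟨ρ, h'⟩)).succ else 0
  let H : Fin Δ.card × (Fin (q ^ m) × Fin (q ^ m)) → Fin N → Fin (q + 1) := fun z ρ =>
    if h : ρ ∈ (δ z.1).1 then (f z.2.1 (eA z.1 ⟨ρ, h⟩)).succ
    else if h' : ρ ∈ (δ z.1).2.1 then (f z.2.2 (eB z.1 ⟨ρ, h'⟩)).succ else 0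
  have hF0 : ∀ x ρ, F x ρ = 0 ↔ ρ ∈ (δ x.1).1 := by
    intro x ρ
    obtain ⟨hab, hac, hbc, hcov⟩ := hpart _ (hδmem x.1)
    simp only [F]
    constructor
    · intro h
      by_cases h1 : ρ ∈ (δ x.1).2.2
      · rw [dif_pos h1] at h; exact absurd h (Fin.succ_ne_zero _)
      · by_cases h2 : ρ ∈ (δ x.1).2.1
        · rw [dif_neg h1, dif_pos h2] at h; exact absurd h (Fin.succ_ne_zero _)
        · have := Finset.eq_univ_iff_forall.1 hcov ρ
          simp only [Finset.mem_union] at this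
          tauto
    · intro h
      rw [dif_neg (Finset.disjoint_left.1 hac h), dif_neg (Finset.disjoint_left.1 hab h)]
  have hG0 : ∀ y ρ, G y ρ = 0 ↔ ρ ∈ (δ y.1).2.1 := by
    intro y ρ
    obtain ⟨hab, hac, hbc, hcov⟩ := hpart _ (hδmem y.1)
    simp only [G]
    constructor
    · intro h
      by_cases h1 : ρ ∈ (δ y.1).2.2
      · rw [dif_pos h1] at h; exact absurd h (Fin.succ_ne_zero _)
      · by_cases h2 : ρ ∈ (δ y.1).1
        · rw [dif_neg h1, dif_pos h2] at h; exact absurd h (Fin.succ_ne_zero _)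
        · have := Finset.eq_univ_iff_forall.1 hcov ρ
          simp only [Finset.mem_union] at this
          tauto
    · intro h
      rw [dif_neg (Finset.disjoint_left.1 hbc h), dif_neg (Finset.disjoint_right.1 hab h)]
  have hH0 : ∀ z ρ, H z ρ = 0 ↔ ρ ∈ (δ z.1).2.2 := by
    intro z ρ
    obtain ⟨hab, hac, hbc, hcov⟩ := hpart _ (hδmem z.1)
    simp only [H]
    constructor
    · intro h
      by_cases h1 : ρ ∈ (δ z.1).1
      · rw [dif_pos h1] at h; exact absurd h (Fin.succ_ne_zero _)
      · by_cases h2 : ρ ∈ (δ z.1).2.1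
        · rw [dif_neg h1, dif_pos h2] at h; exact absurd h (Fin.succ_ne_zero _)
        · have := Finset.eq_univ_iff_forall.1 hcov ρ
          simp only [Finset.mem_union] at this
          tauto
    · intro h
      rw [dif_neg (Finset.disjoint_right.1 hac h), dif_neg (Finset.disjoint_right.1 hbc h)]
  refine ⟨F, G, H, ?_⟩
  funext x y z
  obtain ⟨s, κ, ν⟩ := x
  obtain ⟨s', κ', μ⟩ := y
  obtain ⟨s'', μ', ν'⟩ := z
  rw [kroneckerTensor_apply, kroneckerPow_apply, unitTensor_apply]
  by_cases hs : s = s' ∧ s' = s''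
  · obtain ⟨rfl, rfl⟩ := hs
    rw [if_pos ⟨rfl, rfl⟩, one_mul]
    obtain ⟨hab, hac, hbc, hcov⟩ := hpart _ (hδmem s)
    have key := twisted_block_diag K τ hab hac hbc hcov (eA s) (eB s) (eC s) (f κ) (f ν) (f κ')
      (f μ) (f μ') (f ν') (F (s, κ, ν)) (G (s, κ', μ)) (H (s, μ', ν'))
      (fun ρ h => (hF0 _ ρ).2 h)
      (fun ρ h => by simp only [F]; rw [dif_pos h])
      (fun ρ h => by simp only [F]; rw [dif_neg (Finset.disjoint_left.1 hbc h), dif_pos h])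
      (fun ρ h => (hG0 _ ρ).2 h)
      (fun ρ h => by simp only [G]; rw [dif_pos h])
      (fun ρ h => by simp only [G]; rw [dif_neg (Finset.disjoint_left.1 hac h), dif_pos h])
      (fun ρ h => (hH0 _ ρ).2 h)
      (fun ρ h => by simp only [H]; rw [dif_pos h])
      (fun ρ h => by simp only [H]; rw [dif_neg (Finset.disjoint_right.1 hab h), dif_pos h])
    rw [key]
    simp only [matMulTensor]
    by_cases h : κ = κ' ∧ μ = μ' ∧ ν = ν'
    · rw [if_pos h, if_pos ⟨by rw [h.1], by rw [h.2.1], by rw [h.2.2]⟩]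
    · rw [if_neg h, if_neg fun h' => h ⟨(hf _ _).1 h'.1, (hf _ _).1 h'.2.1, (hf _ _).1 h'.2.2⟩]
  · rw [if_neg hs, zero_mul]
    by_contra hne
    obtain ⟨h1, h2, h3, h4⟩ := twisted_block_support (K := K) τ (F (s, κ, ν)) (G (s', κ', μ))
      (H (s'', μ', ν')) (hF0 _) (hG0 _) (hH0 _) (Ne.symm hne)
    obtain ⟨e1, e2⟩ := hfree _ (hδmem s) _ (hδmem s') _ (hδmem s'') h1 h2 h3 h4
    exact hs ⟨hδinj e1, hδinj e2⟩

end Summit.MatrixMultiplication.MatrixMultiplication.Theorems.SupportRankDoor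

end
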